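import Summits.NavierStokesRegularity.NavierStokesRegularity.Theorems.FilamentSkeletonRssSkeletonJ1RLineDefs

/-!
# Crux `SkeletonJ1R` (stmt-NavierStokesRegularity-23610) · crux-ideate slot 3 g4 · card `inherited-clause13-aposteriori` — first lemmas

(T) `injectivity_transfer` — the a-posteriori transfer of a left-inverse bound along the Kantorovich segment (PROVED, abstract).
(S1) `FineFixedPointInjL` — the closing's output shape `FineFixedPointL` ENRICHED with the inherited collar-C¹ injectivity AT THE OUTPUT skeleton
     (what K-B′ + L′ give for free by (T) once the closing exports its Newton radius and Lipschitz modulus).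
(S2) `SharpRateRowAtOutputL` — the ℓ-form of the 13-R rate row at an exact switched-tangent skeleton: `|dα|·ℓ ≤ cR·L`, `ℓ = Rb√(Γ log Γ)`
     (range condition of the clamped, bending-dominated in-ball operator; stronger than the √Γ-window form of 23612's stub R).
HONEST FRAMING: MODEL rung, negative (∃-) side; Props are posited, never asserted; nothing about NS regularity is proved or moved.
-/

set_option linter.dupNamespace false

noncomputable section

namespace Summit.NavierStokesRegularity.NavierStokesRegularity.Cruxes.SkeletonJ1R.InheritedClause13

open Set Function Filter Real
open Literature.Analysis.FluidPDE
open Summit.NavierStokesRegularity.NavierStokesRegularity.Theorems.SkeletonJ1RFrame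
open Summit.NavierStokesRegularity.NavierStokesRegularity.Theorems.FilamentSkeletonRssSkeletonJ1GSplit (NearStraightJ1G StraightDatum)
open scoped InnerProductSpace Topology BigOperators

/-- (T) A-POSTERIORI INJECTIVITY TRANSFER (the lever, abstract form; sorry-free).  If `A` has a left-inverse bound `‖z‖ ≤ K‖Az‖` and `B` is
`ω`-close to `A` in operator norm with `Kω < 1`, then `B` has the left-inverse bound `K/(1-Kω)`.  With `A = DF(x)` (reference, stub L′),
`B = DF(X*)` (the closing's output) and `ω = Lip(DF)·‖X* − x‖` (the Newton–Kantorovich data of stub K-B′, `Kω ≤ 2h < 1`), this is clause-13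
injectivity at the CONSTRUCTED skeleton in the heart's own currency. [folklore] -/
theorem injectivity_transfer {E F : Type*} [NormedAddCommGroup E] [NormedSpace ℝ E] [NormedAddCommGroup F] [NormedSpace ℝ F]
    (A B : E →L[ℝ] F) {K ω : ℝ} (hK : 0 ≤ K) (hKω : K * ω < 1)
    (hinj : ∀ z, ‖z‖ ≤ K * ‖A z‖) (hclose : ‖B - A‖ ≤ ω) : ∀ z, ‖z‖ ≤ K / (1 - K * ω) * ‖B z‖ := by
  intro z
  have h1 : ‖A z‖ ≤ ‖B z‖ + ω * ‖z‖ := by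
    have hBA : ‖(B - A) z‖ ≤ ω * ‖z‖ :=
      (ContinuousLinearMap.le_opNorm _ _).trans (mul_le_mul_of_nonneg_right hclose (norm_nonneg _))
    have : A z = B z - (B - A) z := by simp
    calc ‖A z‖ = ‖B z - (B - A) z‖ := by rw [this]
      _ ≤ ‖B z‖ + ‖(B - A) z‖ := norm_sub_le _ _
      _ ≤ ‖B z‖ + ω * ‖z‖ := by linarith [hBA]
  have h3 : K * ‖A z‖ ≤ K * (‖B z‖ + ω * ‖z‖) := mul_le_mul_of_nonneg_left h1 hK
  have h2 : (1 - K * ω) * ‖z‖ ≤ K * ‖B z‖ := by nlinarith [hinj z, h3]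
  have hpos : 0 < 1 - K * ω := by linarith
  rw [div_mul_eq_mul_div, le_div_iff₀ hpos]
  linarith [h2, mul_comm (1 - K * ω) ‖z‖]

/-- (S1) THE CLOSING'S OUTPUT WITH INHERITED INJECTIVITY (posited; the re-export the card asks of K-B′): as `FineFixedPointL`, and IN ADDITION the
output skeleton `X` carries the collar-`C¹` injectivity of `ReferenceInjectivityL1` with fields normal to `X′`, the switched defect linearised AT `X`, the
collar measured by `‖X j τ‖`, and a Γ-uniform constant `K` — obtained from L′ by `injectivity_transfer` with the Newton radius and Lipschitz modulus
the Kantorovich closing already controls (`Kω ≤ 2h → 0`). (route-posited statement for crux 23610; not a Literature fact) -/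
def FineFixedPointInjL : Prop :=
  ∀ (N : ℕ) (δd ρd Λd Rwd θd mw : ℝ) (p t : Fin N → EuclideanSpace ℝ (Fin 3)) (γ : Fin N → ℝ) (α : ℝ) (s₀ : Fin N → ℝ),
    0 < N → 0 < δd → 0 < ρd → 0 < Rwd → 0 < θd → 0 < mw → StraightDatum N δd ρd Λd Rwd θd mw p t γ α s₀ →
    (∀ j k, j ≠ k → |⟪t j, t k⟫_ℝ| ≤ 1 - θd) →
    ∃ Rb₁ : ℝ, 0 < Rb₁ ∧ ∀ Rb : ℝ, 0 < Rb → Rb ≤ Rb₁ → ∃ (Γ₂ K : ℝ), 0 < K ∧ ∀ Γ : ℝ, Γ₂ ≤ Γ →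
      ∀ (x : Fin N → ℝ → EuclideanSpace ℝ (Fin 3)) (M : EuclideanSpace ℝ (Fin 3) → EuclideanSpace ℝ (Fin 3)),
        IsLiaReference Γ Rb p t γ α s₀ x → SlicedFrame Γ ρd 1 Rb p t s₀ x M →
        ∃ X : Fin N → ℝ → EuclideanSpace ℝ (Fin 3),
          FineClass Γ δd Λd Rb γ α x X ∧ SwitchedTangent Γ Rb γ α M 1 X ∧ RegularWaist Γ ρd Rb γ α x M 1 X ∧
          ∀ (Y : Fin N → ℝ → EuclideanSpace ℝ (Fin 3)) (B L : ℝ) (Df : Fin N → ℝ → EuclideanSpace ℝ (Fin 3)),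
            (∀ j, ContDiff ℝ 2 (Y j)) → (∀ j τ, ⟪Y j τ, deriv (X j) τ⟫_ℝ = 0) →
            (∀ j τ, ‖Y j τ‖ + ‖deriv (Y j) τ‖ + ‖iteratedDeriv 2 (Y j) τ‖ ≤ B) →
            (∀ j τ, HasDerivAt (fun s : ℝ => swDefect Γ Rb γ α M (fun k σ => X k σ + s • Y k σ) j τ) (Df j τ) 0) →
            (∀ j τ, ‖Df j τ‖ ≤ L) →
            (∀ j τ, (Rb * Real.sqrt (Γ * Real.log Γ)) ^ 2 ≤ ‖X j τ‖ ^ 2 → ‖X j τ‖ ^ 2 ≤ 2 * (Rb * Real.sqrt (Γ * Real.log Γ)) ^ 2 →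
                ∃ D' : EuclideanSpace ℝ (Fin 3), HasDerivAt (Df j) D' τ ∧ Rb * Real.sqrt (Γ * Real.log Γ) * ‖D'‖ ≤ L) →
            ∀ j τ, ‖Y j τ‖ ≤ K * L

/-- (S2) SHARP RATE ROW AT AN EXACT SWITCHED-TANGENT SKELETON (posited, L-sized): for every `C²` field normal to `X′`, CLAMPED to the crux ball
`‖X j τ‖ ≤ ℓ` (`ℓ = Rb√(Γ log Γ)`), satisfying the phase condition, and every rate `dα`, if the in-ball linearised switched defect bordered by the
rotation column `P_n(e₃ × X_j τ)` is flat-bounded by `L`, then `|dα|·ℓ ≤ cR·L` — the ℓ-form forced by the range (moment) condition of the clamped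
bending-dominated operator (tilt floor `‖P_n(e₃ × X′)‖ ≥ sin θ`), which makes the bordered forcing `Df + dα·P_n(e₃ × X)` FLAT `O(L)` on the ball;
it implies the √Γ-form of clause 13-R since `√Γ ≤ ℓ` for `log Γ ≥ Rb⁻²`. (route-posited statement for crux 23610; not a Literature fact) -/
def SharpRateRowAtOutputL : Prop :=
  ∀ (N : ℕ) (δd ρd Λd Rwd θd mw : ℝ) (p t : Fin N → EuclideanSpace ℝ (Fin 3)) (γ : Fin N → ℝ) (α : ℝ) (s₀ : Fin N → ℝ),
    0 < N → 0 < δd → 0 < ρd → 0 < Rwd → 0 < θd → 0 < mw → StraightDatum N δd ρd Λd Rwd θd mw p t γ α s₀ →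
    (∀ j k, j ≠ k → |⟪t j, t k⟫_ℝ| ≤ 1 - θd) →
    ∃ Rb₁ : ℝ, 0 < Rb₁ ∧ ∀ Rb : ℝ, 0 < Rb → Rb ≤ Rb₁ → ∃ (Γ₂ cR : ℝ), 0 < cR ∧ ∀ Γ : ℝ, Γ₂ ≤ Γ →
      ∀ (x X : Fin N → ℝ → EuclideanSpace ℝ (Fin 3)) (M : EuclideanSpace ℝ (Fin 3) → EuclideanSpace ℝ (Fin 3)),
        IsLiaReference Γ Rb p t γ α s₀ x → SlicedFrame Γ ρd 1 Rb p t s₀ x M →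
        FineClass Γ δd Λd Rb γ α x X → SwitchedTangent Γ Rb γ α M 1 X →
        ∀ (Y : Fin N → ℝ → EuclideanSpace ℝ (Fin 3)) (dα L : ℝ) (Df : Fin N → ℝ → EuclideanSpace ℝ (Fin 3)),
          (∀ j, ContDiff ℝ 2 (Y j)) → (∀ j τ, ⟪Y j τ, deriv (X j) τ⟫_ℝ = 0) →
          (∀ j τ, Rb * Real.sqrt (Γ * Real.log Γ) < ‖X j τ‖ → Y j τ = 0) →
          ∑ j, ⟪Y j 0, cross (EuclideanSpace.single 2 1) (X j 0)⟫_ℝ = 0 →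
          (∀ j τ, HasDerivAt (fun s : ℝ => swDefect Γ Rb γ α M (fun k σ => X k σ + s • Y k σ) j τ) (Df j τ) 0) →
          (∀ j τ, ‖X j τ‖ ≤ Rb * Real.sqrt (Γ * Real.log Γ) →
              ‖Df j τ - dα • (cross (EuclideanSpace.single 2 1) (X j τ) -
                ⟪cross (EuclideanSpace.single 2 1) (X j τ), deriv (X j) τ⟫_ℝ • deriv (X j) τ)‖ ≤ L) →
          |dα| * (Rb * Real.sqrt (Γ * Real.log Γ)) ≤ cR * L

end Summit.NavierStokesRegularity.NavierStokesRegularity.Cruxes.SkeletonJ1R.InheritedClause13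

end
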